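import Mathlib
import HarnessLib
import Summits.HubbardSuperconductivity.HubbardSuperconductivity.Theorems.KLProgrammeKLRegimeSplitFrameLemmas
import Summits.HubbardSuperconductivity.HubbardSuperconductivity.Theorems.KLProgrammePerturbedFermiCurveDefs

/-!
# Route `KLProgramme` — D1″ v2: the two-leg LOCAL PART read ON THE FRAME'S FERMI CURVE, its pieces, and the per-scale
# predicates `RenormalisedAtF` / `TwoLegStepF` of the glued split of crux K3 `KLRegimeTwoPointLimit`
# (stmt-HubbardSuperconductivity-19937; seat p2, generation g4, defects Δ9/Δ10 of 2026-08-26)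

Why a second version of D1″ (`KLProgrammeKLRegimeSplitConsts` §3 / `…SplitPredicates` §4, §8).  The v1 carrier
`klTwoLegPoly … K n = symInterp (klLocSelfEnergyRe … K n)` interpolates the real part of the two-leg vertex function of the scale-`n`
action at the lowest Matsubara pair `±ω₀` over ALL lattice momenta.  That vertex function is the CONNECTED-AMPUTATED (Wilsonian)
kernel of `effAction C^K_{>Λ_n} V_K`: `W₂ = A − A·C^K_{>Λ_n}·A + …` with `A = K + Σ^{1PI}` and, at the reading point,
`C^K_{>Λ_n}(ω₀, k⃗) = w_n(k⃗)/(−iω₀ + e_K(k⃗))`, `w_n = χ₂((ω₀² + e_K²)/Λ_n²)` (`hubbardCovAboveCT`, `salmhoferCutoff`), which is NOT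
zero on the cutoff-overlap annulus `ω₀² + e_K² > Λ_n²/4`.  There the one-particle-REDUCIBLE term `+w_n·(Im Σ^{1PI})²·e_K/(ω₀²+e_K²)`,
with `Im Σ^{1PI}(ω₀, k⃗_F) = −c_z U² ω₀`, `c_z ≠ 0` frame-independent (second order; the cell's kit job j247717 gives
`c_z ≈ 0.03–0.04` on the window, `T`-independent), has sup `≍ c_z²U⁴ω₀²/Λ_n` and `j`-th derivatives `≍ c_z²U⁴ω₀²Λ_n^{-1-j}`, so the
v1 pieces violate the (E3a) majorants `twoLegBar j n ∝ (Λ_n/e₀)^{2-j}` by the factor `≍ ω₀²/Λ_n³ ≥ β/(64π)` at the bottom scales —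
for every frame, every fixed `c > 0` and all small `U` (Δ10).  BGM 2006 never see this because their localisation `ℒ` reads the
two-leg kernel ON THE FERMI CURVE, where the ultraviolet weight vanishes (`w_n(ω₀, k⃗_F) = χ₂(ω₀²/Λ_n²) = 0` for `Λ_n ≥ 2ω₀`, and at
the last scale the reducible factor is `1 + O(U²)`).  This module therefore READS AS BGM DO:

* `klFermiPoint μ K θ` — the point of the frame's Fermi curve `{e_K = 0}` on the ray of angle `θ` (p4's `perturbedFermiRadius`
  with `δ = −K`, times `dir θ`);
* `klLocalPart … K n θ` — the LOCAL PART `ν_n(K)(θ)`: the `C₄ᵥ`-symmetrised trigonometric interpolant of the scale-`n` two-leg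
  value `klLocSelfEnergyRe … K n` (v1's reading, which CONTAINS the frame vertex `K`) evaluated at `klFermiPoint μ K θ`;
* `klTubeCutoff L μ k⃗` — a smooth radial cutoff of the FREE band's tube (`= 1` for `|ε − μ| ≤ 3/160`, `= 0` for `|ε − μ| ≥ 3/80`;
  frame-independent, so that the algebra of the pieces telescopes exactly);
* `klFrameExt L μ f` — the NORMAL-FORM frame built from an angular function `f`: the interpolant of `k⃗ ↦ χ_tube(k⃗)·f(θ(k⃗))`
  (constant along rays inside the tube); `klFrameProj L μ K` — the normal form of `K` itself (`f = K` read on ITS curve);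
* `klTwoLegPolyF … K n = klFrameExt (ν_n(K))` — `D_n(K)`; the PIECES `klTwoLegPieceF … K n` = `D_0(K) ⊖ P(K)` at `n = 0`
  (the frame vertex's own value on the curve removed — it is not a two-leg OUTPUT), `D_n ⊖ D_{n-1}` for `n ≥ 1`; so
  `Σ_{n ≤ N} ℓ_n = D_N ⊖ P(K)` and the counterterm map of child 2 is `T(K) = P(K) ⊖ D_N(K) = −Σ_n ℓ_n(K)` (normal form), whose fixed
  points have `ν_N ≡ 0` up to `P(K) = K`;
* `RenormalisedAtF … K R n` — the renormalisation predicate, v2: the local part on the curve is within the QUADRATIC tolerance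
  `R.cr·|U|·Λ_n²/e₀` (what the fixed point achieves: `|ν_n| ≤ Σ_{j>n} twoLegBar 0 j`; and what makes the residual-mass loop
  insertions of the last scales one power of `U` down); NO field-strength clause (Δ9: `z` is computed by the engine, not tuned by
  child 2 — it moves to `TwoLegSlopes`);
* (E3a-F) `TwoLegSizesF`, (E3b-F) `TwoLegFloorF` — v1's sizes and tangential floor on the new pieces (same majorants `twoLegBar`,
  `bflBar`); (E3c-F) `FrameLipschitzF hist` — the frame-Lipschitz bound with the comparison frame's history ABSTRACTED
  (`hist : TrigPolyC4v → ℕ → Prop`, supplied by the bundle: split ∧ renorm ∧ engine of the bundle's own version), so that this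
  module does not import any particular `EngineBoundsAt`/`BetaSplitAt` version; (E3d)+(E3e) `TwoLegSlopes R` — the field strength
  `|z_n − 1| ≤ cz|U|` and the normal slope `|Re Σ_n(ω₀,k⃗) − ν_n(θ(k⃗))| ≤ cz|U|·|e_K(k⃗)|` on the scale-`n` shell, ENGINE OUTPUTS
  against child 2's tolerances (both start at second order, so any `cz > 0` is met for `U ≤ U₀(R)`; `R` is chosen before `Q` and
  `U₀` — `KLProgrammeKLRegimeSplitGenericV2`, Δ8); `TwoLegStepF hist` = their conjunction — the `twoLeg` slot of the next bundle.

Definitions only (plus `rfl`-level bookkeeping); nothing is asserted about the model.  References: BGM 2006 [arXiv:cond-mat/0507686]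
§2.3 (2.27)–(2.31) (`ℒ` on the quadratic part), (2.36), (2.40); FST, CPAM 53 (2000) 1350 (the counterterm as a function on the
Fermi surface extended along normals); HOME/P2-C4B.md §9; HOME/DECOMP.md App. C (the umklapp-corner normal form IS a statement
about `∂_θ² ν`).
-/

noncomputable section

namespace Summit.HubbardSuperconductivity.HubbardSuperconductivity.Theorems.KLRegimeSplit

set_option linter.dupNamespace false -- summit = problem name (single-conjunct summit), D-0017

open scoped InnerProductSpace
open Real Finset Literature.MathematicalPhysics.QuantumLattice Literature.Probability.LatticeModels
open Literature.MathematicalPhysics.QuantumLattice.FermiRG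
open Summit.HubbardSuperconductivity.HubbardSuperconductivity.Theorems.KLProgrammeLegKernels
open Summit.HubbardSuperconductivity.HubbardSuperconductivity.Theorems.DispersionFlow
open Summit.HubbardSuperconductivity.HubbardSuperconductivity.Theorems.PerturbedFermiCurve

/-! ## §1 Reading on the frame's Fermi curve -/

/-- **The frame's Fermi point on the ray `θ`**: `u_K(θ)·dir θ`, `u_K = perturbedFermiRadius (−K) μ` — the point of the curve
`{e_K = ε − μ − K = 0}` (`frameLevel μ K = 0`) at polar angle `θ` (p4's canonical selection; a genuine Fermi point whenever `K` is
continuous and small against the distance of `μ` to the band edges, `isBandFermiRadius_perturbedFermiRadius`). -/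
def klFermiPoint (μ : ℝ) (K : TrigPolyC4v) (θ : ℝ) : Fin 2 → ℝ :=
  perturbedFermiRadius (fun p => -K.eval p) μ θ • dir θ

/-- The inner radius of the reading tube, FIXED: `3/160` (half of `FrameOK`'s `r₀ = 3/80`). -/
def klTubeR : ℝ := 3 / 160

/-- **The tube cutoff of the FREE band** at a lattice momentum: `χ_tube(k⃗) = 1 − χ₂((ε(k⃗) − μ)²/(4·klTubeR²))` — equal to `1` for
`|ε − μ| ≤ klTubeR = 3/160`, to `0` for `|ε − μ| ≥ 2·klTubeR = 3/80`, smooth and frame-INDEPENDENT (Salmhofer's `χ₂`,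
`salmhoferCutoff`: `0` on `[0, ¼]`, `1` on `[1, ∞)`). -/
def klTubeCutoff (L : ℕ) [NeZero L] (μ : ℝ) (k : TorusSite 2 L) : ℝ :=
  1 - salmhoferCutoff ((nambuXi L μ k) ^ 2 / (4 * klTubeR ^ 2))

section Model

variable (L M : ℕ) [NeZero L] [NeZero M]

/-- **The LOCAL PART `ν_n(K)(θ)` of the scale-`n` two-leg kernel** (BGM's `ℒ𝒱₂` read at the frame's own Fermi curve): the
`C₄ᵥ`-symmetrised trigonometric interpolant of the localised two-leg value `klLocSelfEnergyRe … K n` (spin- and `±ω₀`-averaged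
`Re Σ_n`; it CONTAINS the frame vertex `K`) evaluated at `klFermiPoint μ K θ`.  On the curve the ultraviolet weight of
`C^K_{>Λ_n}` vanishes for `Λ_n ≥ 2ω₀`, so `ν_n` is free of one-particle-reducible terms (Δ10). -/
def klLocalPart (β U μ : ℝ) (K : TrigPolyC4v) (n : ℕ) (θ : ℝ) : ℝ :=
  (symInterp L (klLocSelfEnergyRe L M β U μ K n)).eval (klFermiPoint μ K θ)

end Model

/-- **Normal-form frame from an angular function**: the `C₄ᵥ`-symmetrised interpolant of `k⃗ ↦ χ_tube(k⃗)·f(θ(k⃗))`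
(`θ(k⃗) = momentumAngle L k⃗`, the polar angle of the centred representative) — constant along rays inside the tube, zero outside. -/
def klFrameExt (L : ℕ) [NeZero L] (μ : ℝ) (f : ℝ → ℝ) : TrigPolyC4v :=
  symInterp L fun k => klTubeCutoff L μ k * f (momentumAngle L k)

/-- **The normal form `P(K)` of a frame**: `klFrameExt` of `K` read on ITS OWN curve, `θ ↦ K(klFermiPoint μ K θ)`. -/
def klFrameProj (L : ℕ) [NeZero L] (μ : ℝ) (K : TrigPolyC4v) : TrigPolyC4v :=
  klFrameExt L μ fun θ => K.eval (klFermiPoint μ K θ)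

section Model

variable (L M : ℕ) [NeZero L] [NeZero M]

/-- **`D_n(K)`** — the scale-`n` local part extended in normal form: `klFrameExt (ν_n(K))`. -/
def klTwoLegPolyF (β U μ : ℝ) (K : TrigPolyC4v) (n : ℕ) : TrigPolyC4v :=
  klFrameExt L μ (klLocalPart L M β U μ K n)

/-- **The scale-`n` two-leg PIECE `ℓ_n(K)`, v2**: `D_0(K) ⊖ P(K)` at `n = 0` (the local part of the ultraviolet step BEYOND the
frame vertex's own value on the curve), `D_n(K) ⊖ D_{n-1}(K)` for `n ≥ 1`; `Σ_{n ≤ N} ℓ_n = D_N ⊖ P(K)`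
(`sum_eval_klTwoLegPieceF`), and child 2's counterterm map is `T(K) = P(K) ⊖ D_N(K) = −Σ_n ℓ_n(K)`. -/
def klTwoLegPieceF (β U μ : ℝ) (K : TrigPolyC4v) (n : ℕ) : TrigPolyC4v :=
  if n = 0 then fsub (klTwoLegPolyF L M β U μ K 0) (klFrameProj L μ K)
  else fsub (klTwoLegPolyF L M β U μ K n) (klTwoLegPolyF L M β U μ K (n - 1))

/-! ## §2 The renormalisation predicate, v2 (quadratic tolerance, local part on the curve, no field-strength clause) -/

/-- **`RenormalisedAtF … K R n`** — the frame is renormalised down to scale `n`, v2: its scale-`n` LOCAL PART on its own Fermi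
curve is within the QUADRATIC tolerance, `|ν_n(K)(θ)| ≤ cr·|U|·Λ_n²/e₀` for every angle `θ` (`Λ_n = klScale klE0 n`).  What the
fixed point of child 2 achieves (`|ν_n| ≤ Σ_{j>n} twoLegBar 0 j ≤ 2.2(S₀+1)|U|Λ_n²/e₀`) and what the engine needs of the residual
mass at the scales below.  The field strength is NOT here (Δ9): it is the engine's output `TwoLegSlopes`. -/
def RenormalisedAtF (β U μ : ℝ) (K : TrigPolyC4v) (R : RenConsts) (n : ℕ) : Prop :=
  ∀ θ : ℝ, |klLocalPart L M β U μ K n θ| ≤ R.cr * |U| * klScale klE0 n ^ 2 / klE0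

/-! ## §3 The two-leg step predicates, v2 -/

/-- **(E3a-F)** the `|h|`-free sizes of the scale-`n` piece (as a function on `Momentum`): `‖Dʲ ℓ_n(K)‖ ≤ twoLegBar j n`, `j ≤ 4`
(majorants of Part 1: `(S_j + S_j′|U|)·uPow j U·4^{(j-2)n}`; the local-part increment is `O(|U|Λ_n²)` with angular structure at
the sector scale and the extension is constant along rays, so these are generous). -/
def TwoLegSizesF (G : GeoConsts) (Q : EngConsts) (β U μ : ℝ) (K : TrigPolyC4v) (n : ℕ) : Prop :=
  ∀ j ≤ 4, ∀ q : Momentum,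
    ‖iteratedFDeriv ℝ j (evalM (klTwoLegPieceF L M β U μ K n)) q‖ ≤ twoLegBar G Q U j n

/-- **(E3b-F)** the per-scale TANGENTIAL FLOOR of the scale-`n` piece along the level sets of the frame band inside the tube
`{|e_K| < 3/80}` (DECOMP App. C: the umklapp-corner logarithm of `∂_θ² ν` is convexity-ENHANCING; only summable / `O(|U|³)` junk
is negative): `hessQuad ℓ_n ≥ −bflBar n·‖t‖²` on tangent vectors. -/
def TwoLegFloorF (G : GeoConsts) (Q : EngConsts) (β U μ : ℝ) (K : TrigPolyC4v) (n : ℕ) : Prop :=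
  ∀ p : Momentum, |frameLevel μ K p| < 3 / 80 → ∀ t : Momentum,
    inner ℝ (gradient (frameLevel μ K) p) t = 0 →
      -(bflBar G Q U n) * ‖t‖ ^ 2 ≤ hessQuad (evalM (klTwoLegPieceF L M β U μ K n)) p t

/-- **(E3c-F)** the frame-LIPSCHITZ bound of the scale-`n` piece, with the comparison frame's history ABSTRACTED: for every
admissible frame `K′` satisfying `hist K′ j` at all `j < n` (the bundle supplies `hist` = its own split ∧ renorm ∧ engine),
`sup_q |ℓ_n(K)(q) − ℓ_n(K′)(q)| ≤ lipBar n · frameDist K K′` (`Σ_n lipBar n = O(|U|)`: contraction of child 2's map; the reading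
point `klFermiPoint μ K θ` moves with the frame — part of the map, as in FST's inversion). -/
def FrameLipschitzF (hist : TrigPolyC4v → ℕ → Prop) (G : GeoConsts) (Q : EngConsts) (R : RenConsts) (β U μ : ℝ)
    (K : TrigPolyC4v) (n : ℕ) : Prop :=
  ∀ K' : TrigPolyC4v, FrameOK R U (klTempScaleIdx β klE0) μ K' → (∀ j < n, hist K' j) →
    ∀ q : Fin 2 → ℝ,
      |(klTwoLegPieceF L M β U μ K n).eval q - (klTwoLegPieceF L M β U μ K' n).eval q| ≤ lipBar G Q U n * frameDist K K'

/-- **(E3d)+(E3e) `TwoLegSlopes R … K n`** — on the scale-`n` shell `S_n = {|e_K| ≤ Λ_n}`: the FIELD STRENGTH of the scale-`n`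
action is within `cz|U|` of `1`, and the two-leg value differs from the local part of its ray by at most `cz|U|·|e_K(k⃗)|` (normal
slope).  ENGINE OUTPUTS stated against child 2's tolerances (`z − 1` and `∂_e Re Σ` start at second order, so every `cz > 0` is met
for `U ≤ U₀(R)`; `R` is chosen before `Q` and `U₀`, `KLProgrammeKLRegimeSplitGenericV2`).  Replaces the field-strength clause of v1's
`RenormalisedAt`, which no slot supplied (Δ9). -/
def TwoLegSlopes (R : RenConsts) (β U μ : ℝ) (K : TrigPolyC4v) (n : ℕ) : Prop :=
  ∀ k ∈ klShell L μ K n,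
    |klFieldStrength L M β U μ K n k - 1| ≤ R.cz * |U| ∧
      |klLocSelfEnergyRe L M β U μ K n k - klLocalPart L M β U μ K n (momentumAngle L k)| ≤
        R.cz * |U| * |nambuXiCT L μ K k|

/-- **`TwoLegStepF hist G P Q R … K n`** = (E3a-F) ∧ (E3b-F) ∧ (E3c-F) ∧ (E3d/e): the two-leg output of the scale-`n` step in the
form child 2's inversion consumes (sizes + floor ⇒ self-map of the frame ball; Lipschitz ⇒ contraction; slopes ⇒ the next scales'
two-leg vertex is small on their support).  The `twoLeg` slot of the bundle `klPredsV4` (with `hist` = that bundle's history);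
`P` is carried for slot-shape uniformity. -/
def TwoLegStepF (hist : TrigPolyC4v → ℕ → Prop) (G : GeoConsts) (_P : SplitConsts) (Q : EngConsts) (R : RenConsts)
    (β U μ : ℝ) (K : TrigPolyC4v) (n : ℕ) : Prop :=
  TwoLegSizesF L M G Q β U μ K n ∧ TwoLegFloorF L M G Q β U μ K n ∧
    FrameLipschitzF L M hist G Q R β U μ K n ∧ TwoLegSlopes L M R β U μ K n

end Model

/-! ## §4 Bookkeeping lemmas -/

/-- `klTubeR = 3/160`. -/
theorem klTubeR_eq : klTubeR = 3 / 160 := rfl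

/-- `0 < klTubeR`. -/
theorem klTubeR_pos : 0 < klTubeR := by norm_num [klTubeR]

/-- The tube cutoff is `1` on the inner tube `|ε − μ| ≤ 3/160`. -/
theorem klTubeCutoff_eq_one {L : ℕ} [NeZero L] {μ : ℝ} {k : TorusSite 2 L} (h : |nambuXi L μ k| ≤ klTubeR) :
    klTubeCutoff L μ k = 1 := by
  unfold klTubeCutoff
  have h0 : 0 ≤ |nambuXi L μ k| := abs_nonneg _
  have h2 : nambuXi L μ k ^ 2 ≤ klTubeR ^ 2 := by
    rw [← sq_abs]; exact pow_le_pow_left₀ h0 h 2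
  have h4 : 0 < 4 * klTubeR ^ 2 := mul_pos (by norm_num) (pow_pos klTubeR_pos 2)
  have hx : nambuXi L μ k ^ 2 / (4 * klTubeR ^ 2) ≤ 1 / 4 := by
    rw [div_le_div_iff₀ h4 (by norm_num)]
    nlinarith [klTubeR_pos]
  rw [salmhoferCutoff_of_le hx, sub_zero]

/-- The tube cutoff is `0` outside the tube `|ε − μ| ≥ 3/80 = 2·klTubeR`. -/
theorem klTubeCutoff_eq_zero {L : ℕ} [NeZero L] {μ : ℝ} {k : TorusSite 2 L} (h : 2 * klTubeR ≤ |nambuXi L μ k|) :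
    klTubeCutoff L μ k = 0 := by
  unfold klTubeCutoff
  have h2 : (2 * klTubeR) ^ 2 ≤ nambuXi L μ k ^ 2 := by
    rw [← sq_abs (nambuXi L μ k)]
    exact pow_le_pow_left₀ (by nlinarith [klTubeR_pos]) h 2
  have h4 : 0 < 4 * klTubeR ^ 2 := mul_pos (by norm_num) (pow_pos klTubeR_pos 2)
  have hx : 1 ≤ nambuXi L μ k ^ 2 / (4 * klTubeR ^ 2) := by
    rw [le_div_iff₀ h4]
    nlinarith [klTubeR_pos]
  rw [salmhoferCutoff_of_ge hx, sub_self]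

/-- The tube cutoff takes values in `[0, 1]`. -/
theorem klTubeCutoff_mem_Icc (L : ℕ) [NeZero L] (μ : ℝ) (k : TorusSite 2 L) : klTubeCutoff L μ k ∈ Set.Icc (0 : ℝ) 1 := by
  unfold klTubeCutoff
  have h := salmhoferCutoff_mem_Icc (nambuXi L μ k ^ 2 / (4 * klTubeR ^ 2))
  constructor <;> linarith [h.1, h.2]

section Model

variable (L M : ℕ) [NeZero L] [NeZero M]

/-- The two-leg piece at scale `0` is `D_0 ⊖ P(K)`. -/
theorem klTwoLegPieceF_zero (β U μ : ℝ) (K : TrigPolyC4v) :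
    klTwoLegPieceF L M β U μ K 0 = fsub (klTwoLegPolyF L M β U μ K 0) (klFrameProj L μ K) := by
  simp [klTwoLegPieceF]

/-- The two-leg piece at scale `n + 1` is `D_{n+1} ⊖ D_n`. -/
theorem klTwoLegPieceF_succ (β U μ : ℝ) (K : TrigPolyC4v) (n : ℕ) :
    klTwoLegPieceF L M β U μ K (n + 1) = fsub (klTwoLegPolyF L M β U μ K (n + 1)) (klTwoLegPolyF L M β U μ K n) := by
  simp [klTwoLegPieceF]

/-- **Telescoping**: `Σ_{n ≤ N} ℓ_n(K) = D_N(K) ⊖ P(K)` pointwise — the renormalisation condition «`D_N(K) ≈ P(K) = K`» is the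
fixed-point equation `K ≈ −Σ_n ℓ_n(K) + (P(K) − D_N(K)) …` of child 2's map `T(K) = P(K) ⊖ D_N(K)`. -/
theorem sum_eval_klTwoLegPieceF (β U μ : ℝ) (K : TrigPolyC4v) (N : ℕ) (p : Fin 2 → ℝ) :
    ∑ n ∈ range (N + 1), (klTwoLegPieceF L M β U μ K n).eval p =
      (klTwoLegPolyF L M β U μ K N).eval p - (klFrameProj L μ K).eval p := by
  induction N with
  | zero => simp [klTwoLegPieceF_zero, eval_fsub]
  | succ N ih => rw [sum_range_succ, ih, klTwoLegPieceF_succ, eval_fsub]; ring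

/-- Telescoping on `Momentum`. -/
theorem sum_evalM_klTwoLegPieceF (β U μ : ℝ) (K : TrigPolyC4v) (N : ℕ) (q : Momentum) :
    ∑ n ∈ range (N + 1), evalM (klTwoLegPieceF L M β U μ K n) q =
      evalM (klTwoLegPolyF L M β U μ K N) q - evalM (klFrameProj L μ K) q :=
  sum_eval_klTwoLegPieceF L M β U μ K N _

/-- **The shift of child 2's map `T(K) = P(K) ⊖ D_N(K)` is the sum of the pieces**:
`frameShift (P(K) ⊖ D_N(K)) = Σ_{n ≤ N} ℓ_n(K)` on `Momentum` (so `frameGeometry_counterterm`-type lemmas transfer verbatim). -/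
theorem frameShift_counterterm_F (β U μ : ℝ) (K : TrigPolyC4v) (N : ℕ) :
    frameShift (fsub (klFrameProj L μ K) (klTwoLegPolyF L M β U μ K N)) =
      fun q => ∑ n ∈ range (N + 1), evalM (klTwoLegPieceF L M β U μ K n) q := by
  funext q
  show -evalM (fsub (klFrameProj L μ K) (klTwoLegPolyF L M β U μ K N)) q = _
  rw [evalM_fsub, sum_evalM_klTwoLegPieceF]
  ring

/-- `RenormalisedAtF` unfolds to the angle-wise quadratic tolerance. -/
theorem renormalisedAtF_iff (β U μ : ℝ) (K : TrigPolyC4v) (R : RenConsts) (n : ℕ) :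
    RenormalisedAtF L M β U μ K R n ↔
      ∀ θ : ℝ, |klLocalPart L M β U μ K n θ| ≤ R.cr * |U| * klScale klE0 n ^ 2 / klE0 := Iff.rfl

/-- The quadratic tolerance is at most `cr|U|` times the LINEAR scale (`Λ_n ≤ e₀`): `RenormalisedAtF` implies v1's mismatch SHAPE on
the curve, `|ν_n| ≤ cr·|U|·Λ_n`, for `0 ≤ cr`. -/
theorem RenormalisedAtF.le_linear {L M : ℕ} [NeZero L] [NeZero M] {β U μ : ℝ} {K : TrigPolyC4v} {R : RenConsts} {n : ℕ}
    (h : RenormalisedAtF L M β U μ K R n) (hcr : 0 ≤ R.cr) (θ : ℝ) :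
    |klLocalPart L M β U μ K n θ| ≤ R.cr * |U| * klScale klE0 n := by
  refine (h θ).trans ?_
  have he0 : (0 : ℝ) < klE0 := by norm_num [klE0]
  have hΛ : 0 ≤ klScale klE0 n := by unfold klScale; positivity
  have hΛle : klScale klE0 n ≤ klE0 := by
    unfold klScale
    have h4 : (1 : ℝ) ≤ (4 : ℝ) ^ n := one_le_pow₀ (by norm_num)
    have := inv_le_one_of_one_le₀ h4
    nlinarith
  rw [div_le_iff₀ he0]
  have hc : 0 ≤ R.cr * |U| := mul_nonneg hcr (abs_nonneg _)
  calc R.cr * |U| * klScale klE0 n ^ 2 = R.cr * |U| * klScale klE0 n * klScale klE0 n := by ring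
    _ ≤ R.cr * |U| * klScale klE0 n * klE0 := by
        exact mul_le_mul_of_nonneg_left hΛle (mul_nonneg hc hΛ)

end Model

end Summit.HubbardSuperconductivity.HubbardSuperconductivity.Theorems.KLRegimeSplit

end
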